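import Summits.AnomalousDissipation.AnomalousDissipation.Theses.FrustratedForces
import Summits.AnomalousDissipation.AnomalousDissipation.Theorems.MirrorVarietyFixedViscosityTransfer
import Literature.Analysis.FunctionSpaces.TorusLinearisedFormTruncation
import Literature.Analysis.FluidPDE.CheskidovAssemblyTools

/-!
# `stub_powerFloorTransfer` — power-floor transfer at fixed viscosity WITHOUT an energy hypothesis

Supports crux `GPLoudFamilyZ` (stmt-AnomalousDissipation-10436, route FrustratedForces), registered stub of line
`Cruxes/GPLoudFamilyZ/Lines/fat_half_branch.lean` (name + signature verbatim).  At fixed `ν > 0`, a power floor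
`ε ≤ ν‖∇U_N‖²` on tested Fourier–Galerkin steady states of `NS_ν(f)` at infinitely many resolutions `N` passes to a steady
weak solution `u ∈ V` with `(u,f) ≥ ε` and the energy identity.  This is the landed
`Theorems.FixedViscosityTransfer_proof` (MirrorVariety stmt-2991) minus its energy hypothesis `∫|U|² ≤ E`, which is
automatic at fixed `ν`: testing the Galerkin equations with `a = U` gives `ν‖∇U‖² = ∫⟪f,U⟫`
(`Theorems.galerkin_energy_identity_of_tested`), Cauchy–Schwarz bounds the right side by `‖f‖₂ (∫|U|²)^{1/2}`, and
Poincaré `4π²∫|U|² ≤ ‖∇U‖²` (`Torus.four_pi_sq_mul_integral_norm_sq_le_gradNormSq`) yields the a-priori bound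
`∫|U|² ≤ ‖f‖₂² / (16π⁴ν²) =: E`, after which `FixedViscosityTransfer_proof ν E ε f` applies verbatim.
[cite: Temam1979, Ch. II Thm. 1.2 and (1.29)]
-/

set_option linter.dupNamespace false

noncomputable section

open Filter Set Topology MeasureTheory
open scoped InnerProductSpace

namespace Summit.AnomalousDissipation.AnomalousDissipation.Theorems.GPLoudFamilyZ.PowerFloorTransfer

open Literature.Analysis.FunctionSpaces Literature.Analysis.FunctionSpaces.Torus

/-- **A-priori energy bound for tested Galerkin steady states** (Temam 1979, Ch. II (1.29)–(1.30)): if `U` is smooth,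
divergence-free and mean-zero and satisfies the tested steady Galerkin equation with the test field `a = U` itself, then
`∫|U|² ≤ (∫|f|²)/(16π⁴ν²)`. [cite: Temam1979, Ch. II (1.30)] -/
theorem galerkin_energy_apriori {ν : ℝ} (hν : 0 < ν) {f U : UnitAddTorus (Fin 3) → EuclideanSpace ℝ (Fin 3)}
    (hf : IsSmooth f) (hU : IsSmooth U) (hdiv : IsDivFree U) (h0 : HasZeroMean U)
    (htest : ∫ x, (⟪U x, Torus.convect U U x⟫_ℝ + ν * ⟪U x, Torus.laplacian U x⟫_ℝ + ⟪f x, U x⟫_ℝ) = 0) :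
    ∫ x, ‖U x‖ ^ 2 ≤ (∫ x, ‖f x‖ ^ 2) / (16 * Real.pi ^ 4 * ν ^ 2) := by
  have hid : ν * gradNormSq U = ∫ x, ⟪f x, U x⟫_ℝ :=
    Summit.AnomalousDissipation.AnomalousDissipation.Theorems.galerkin_energy_identity_of_tested (hf.memLp 2) hU hdiv htest
  have hP := four_pi_sq_mul_integral_norm_sq_le_gradNormSq hU h0
  have hCS := Literature.Analysis.FluidPDE.abs_integral_inner_le_sqrt_mul_sqrt (hf.memLp 2) (hU.memLp 2)
  set X : ℝ := ∫ x, ‖U x‖ ^ 2 with hX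
  set F2 : ℝ := ∫ x, ‖f x‖ ^ 2 with hF2
  have hX0 : 0 ≤ X := integral_nonneg fun x => sq_nonneg _
  have hF0 : 0 ≤ F2 := integral_nonneg fun x => sq_nonneg _
  -- 4π²ν X ≤ ν‖∇U‖² = ∫⟪f,U⟫ ≤ √F2 √X
  have h1 : 4 * Real.pi ^ 2 * ν * X ≤ Real.sqrt F2 * Real.sqrt X := by
    calc 4 * Real.pi ^ 2 * ν * X = ν * (4 * Real.pi ^ 2 * X) := by ring
      _ ≤ ν * gradNormSq U := mul_le_mul_of_nonneg_left hP hν.le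
      _ = ∫ x, ⟪f x, U x⟫_ℝ := hid
      _ ≤ |∫ x, ⟪f x, U x⟫_ℝ| := le_abs_self _
      _ ≤ Real.sqrt F2 * Real.sqrt X := hCS
  -- hence √X ≤ √F2 / (4π²ν), i.e. X ≤ F2 / (16π⁴ν²)
  have hπ : 0 < 4 * Real.pi ^ 2 * ν := by positivity
  rcases (Real.sqrt_nonneg X).lt_or_eq with hpos | hzero
  · have h1' : (4 * Real.pi ^ 2 * ν * Real.sqrt X) * Real.sqrt X ≤ Real.sqrt F2 * Real.sqrt X := by
      calc (4 * Real.pi ^ 2 * ν * Real.sqrt X) * Real.sqrt X = 4 * Real.pi ^ 2 * ν * (Real.sqrt X * Real.sqrt X) := by ring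
        _ = 4 * Real.pi ^ 2 * ν * X := by rw [Real.mul_self_sqrt hX0]
        _ ≤ Real.sqrt F2 * Real.sqrt X := h1
    have h3 : 4 * Real.pi ^ 2 * ν * Real.sqrt X ≤ Real.sqrt F2 := le_of_mul_le_mul_right h1' hpos
    have h4 : Real.sqrt X ≤ Real.sqrt F2 / (4 * Real.pi ^ 2 * ν) := by
      rw [le_div_iff₀ hπ]; linarith [h3]
    have h5 : X ≤ (Real.sqrt F2 / (4 * Real.pi ^ 2 * ν)) ^ 2 := by
      rw [← Real.sq_sqrt hX0]
      exact pow_le_pow_left₀ (Real.sqrt_nonneg X) h4 2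
    calc X ≤ (Real.sqrt F2 / (4 * Real.pi ^ 2 * ν)) ^ 2 := h5
      _ = F2 / (16 * Real.pi ^ 4 * ν ^ 2) := by
        rw [div_pow, Real.sq_sqrt hF0]; ring
  · have hX' : X = 0 := by
      have := Real.sqrt_eq_zero'.1 hzero.symm
      exact le_antisymm this hX0
    rw [hX']
    positivity

/-- Registered stub of line `fat-half-branch` (name + signature verbatim): **power-floor transfer at fixed viscosity without
an energy hypothesis**. [cite: Temam1979, Ch. II Thm. 1.2] -/
theorem stub_powerFloorTransfer :
    ∀ (ν ε : ℝ) (f : UnitAddTorus (Fin 3) → EuclideanSpace ℝ (Fin 3)), 0 < ν → Literature.Analysis.FunctionSpaces.Torus.IsSmooth f → Literature.Analysis.FunctionSpaces.Torus.IsDivFree f → Literature.Analysis.FunctionSpaces.Torus.HasZeroMean f → (∃ᶠ N in Filter.atTop, ∃ U : UnitAddTorus (Fin 3) → EuclideanSpace ℝ (Fin 3), (Literature.Analysis.FunctionSpaces.Torus.IsSmooth U ∧ Literature.Analysis.FunctionSpaces.Torus.IsDivFree U ∧ Literature.Analysis.FunctionSpaces.Torus.HasZeroMean U ∧ (∀ k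 ∉ (Literature.Analysis.FunctionSpaces.Torus.freqBall N).erase (0 : Fin 3 → ℤ), UnitAddTorus.mFourierCoeff (Literature.Analysis.FunctionSpaces.EuclideanSpace.complexify ∘ U) k = 0) ∧ ∀ a : UnitAddTorus (Fin 3) → EuclideanSpace ℝ (Fin 3), Literature.Analysis.FunctionSpaces.Torus.IsSmooth a → Literature.Analysis.FunctionSpaces.Torus.IsDivFree a → (∀ k ∉ (Literature.Analysis.FunctionSpaces.Torus.freqBall N).erase (0 : Fin 3 → ℤ), UnitAddTorus.mFourierCoeff (Literature.Analysis.FunctionSpaces.EuclideanSpace.complexify ∘ a) k = 0) → ∫ x, (inner ℝ (U x) (Literature.Analysis.FunctionSpaces.Torus.convect U a x) + ν * inner ℝ (U x) (Literature.Analysis.FunctionSpaces.Torus.laplacian a x) + inner ℝ (f x) (a x)) = 0) ∧ ε ≤ ν * Literature.Analysis.FunctionSpaces.Torus.gradNormSq U) → ∃ u : ↥(Literature.Analysis.FunctionSpaces.Torus.energySpace (Fin 3)), (u : MeasureTheory.Lp (EuclideanSpace ℝ (Fin 3)) 2 (MeasureTheory.volume : MeasureTheory.Measure (UnitAddTorus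 (Fin 3)))) ∈ Literature.Analysis.FunctionSpaces.Torus.energySpaceV (Fin 3) ∧ Literature.Analysis.FluidPDE.Torus.IsSteadyWeakSolution ν f u ∧ ε ≤ Literature.Analysis.FluidPDE.Torus.pairing (u : MeasureTheory.Lp (EuclideanSpace ℝ (Fin 3)) 2 (MeasureTheory.volume : MeasureTheory.Measure (UnitAddTorus (Fin 3)))) f ∧ ν * (Literature.Analysis.FunctionSpaces.Torus.eGradNormSq ((u : MeasureTheory.Lp (EuclideanSpace ℝ (Fin 3)) 2 (MeasureTheory.volume : MeasureTheory.Measure (UnitAddTorus (Fin 3)))) : UnitAddTorus (Fin 3) → EuclideanSpace ℝ (Fin 3))).toReal = Literature.Analysis.FluidPDE.Torus.pairing (u : MeasureTheory.Lp (EuclideanSpace ℝ (Fin 3)) 2 (MeasureTheory.volume : MeasureTheory.Measure (UnitAddTorus (Fin 3)))) f := by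
  intro ν ε f hν hf hfd hfz hfreq
  set E : ℝ := (∫ x, ‖f x‖ ^ 2) / (16 * Real.pi ^ 4 * ν ^ 2) with hE
  have hfreq' : ∃ᶠ N in Filter.atTop, ∃ U : UnitAddTorus (Fin 3) → EuclideanSpace ℝ (Fin 3), (Literature.Analysis.FunctionSpaces.Torus.IsSmooth U ∧ Literature.Analysis.FunctionSpaces.Torus.IsDivFree U ∧ Literature.Analysis.FunctionSpaces.Torus.HasZeroMean U ∧ (∀ k ∉ (Literature.Analysis.FunctionSpaces.Torus.freqBall N).erase (0 : Fin 3 → ℤ), UnitAddTorus.mFourierCoeff (Literature.Analysis.FunctionSpaces.EuclideanSpace.complexify ∘ U) k = 0) ∧ ∀ a : UnitAddTorus (Fin 3) → EuclideanSpace ℝ (Fin 3), Literature.Analysis.FunctionSpaces.Torus.IsSmooth a → Literature.Analysis.FunctionSpaces.Torus.IsDivFree a → (∀ k ∉ (Literature.Analysis.FunctionSpaces.Torus.freqBall N).erase (0 : Fin 3 → ℤ), UnitAddTorus.mFourierCoeff (Literature.Analysis.FunctionSpaces.EuclideanSpace.complexify ∘ a) k = 0) → ∫ x, (inner ℝ (U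 x) (Literature.Analysis.FunctionSpaces.Torus.convect U a x) + ν * inner ℝ (U x) (Literature.Analysis.FunctionSpaces.Torus.laplacian a x) + inner ℝ (f x) (a x)) = 0) ∧ ∫ x, ‖U x‖ ^ 2 ≤ E ∧ ε ≤ ν * Literature.Analysis.FunctionSpaces.Torus.gradNormSq U := by
    refine hfreq.mono ?_
    rintro N ⟨U, hU, hεU⟩
    exact ⟨U, hU, galerkin_energy_apriori hν hf hU.1 hU.2.1 hU.2.2.1 (hU.2.2.2.2 U hU.1 hU.2.1 hU.2.2.2.1), hεU⟩
  obtain ⟨u, hV, hsol, -, hε, heq⟩ :=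
    Summit.AnomalousDissipation.AnomalousDissipation.Theorems.FixedViscosityTransfer_proof ν E ε f hν hf hfd hfz hfreq'
  exact ⟨u, hV, hsol, hε, heq⟩

end Summit.AnomalousDissipation.AnomalousDissipation.Theorems.GPLoudFamilyZ.PowerFloorTransfer

end
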